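import Mathlib.Analysis.SpecialFunctions.Integrals.Basic
import Mathlib.Analysis.SpecialFunctions.Trigonometric.Bounds
import Mathlib.Analysis.Calculus.Deriv.Polynomial
import Mathlib.Analysis.Complex.Basic
import Mathlib.Analysis.SpecificLimits.Normed
import Mathlib.Analysis.Normed.Group.Tannery
import Mathlib.Analysis.PSeries
import Mathlib.MeasureTheory.Integral.IntervalIntegral.IntegrationByParts
import Mathlib.MeasureTheory.Integral.DominatedConvergence
import Mathlib.Algebra.Polynomial.Derivative
import Mathlib.Topology.Algebra.Polynomial
import HarnessLib

/-!
# Cotangent moments: `∫₀¹ P(x) cot(πx/2) dx` for a polynomial vanishing at `0` and `1`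

For a real polynomial `P` with `P(0) = P(1) = 0`,

`∫₀¹ P(x) cot(πx/2) dx = 2 ∑_{j ≥ 1} (-1)ʲ [P⁽²ʲ⁾(0) + (1 - 4⁻ʲ) P⁽²ʲ⁾(1)] ζ(2j+1) / π^{2j+1}`,

with `ζ(s) = ∑_{m ≥ 1} m^{-s}` — Lemma 2.3 of Lai–Lupu–Orr [LaiLupuOrr2026] (there with the extra
term `2P(1) log 2/π` for `P(1) ≠ 0`, taken from Orr's cotangent integrals via Clausen functions).
This is the second ingredient of their elementary proof of Zagier's evaluation of
`ζ(2,…,2,3,2,…,2)` (Zagier 2012, Theorem 1 = Brown 2012, Theorem 4.1), applied to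
`P = x^{2a+2}(1-x)^{2b+1}` in `Literature.NumberTheory.Transcendental.BrownZagierFormulaProofs`.

## Proof (ours; avoids Clausen functions and the Fourier series of `log sin`)

Abel summation of the cotangent kernel: `κ_r(θ) = 2r sin θ/(1 - 2r cos θ + r²) = ∑_{m≥1} 2rᵐ sin(mθ)`
(imaginary part of the geometric series, `hasSum_abelCotKernel`) satisfies `|κ_r(θ)| ≤ |cot(θ/2)|`
and `κ_r(θ) → cot(θ/2)` as `r ↑ 1`; hence, `P(x) cot(πx/2)` being bounded on `(0,1]` (`P(0) = 0`),
`∫₀¹ P κ_r(π·) → ∫₀¹ P cot(π·/2)` (dominated convergence). For `r < 1` the integral is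
`∑_m 2rᵐ ∫₀¹ P(x) sin(mπx) dx`, and repeated integration by parts gives the finite closed form
`∫₀¹ Q sin(mπx) = ∑_j (-1)ʲ [Q⁽²ʲ⁾(0) - (-1)ᵐ Q⁽²ʲ⁾(1)]/(mπ)^{2j+1}` (`integral_eval_mul_sin_eq_sum`);
the `j = 0` term vanishes for `P`, and `∑_m rᵐ/mˢ → ζ(s)`, `∑_m (-r)ᵐ/mˢ → -(1 - 2^{1-s}) ζ(s)`
(`s ≥ 3`, Tannery) finish the computation.

## Contents (all proved; no named facts)

* `abelCotKernel`, `hasSum_abelCotKernel`, `abs_abelCotKernel_le`, `tendsto_abelCotKernel`;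
* `integral_eval_mul_sin`, `integral_eval_mul_cos`, `integral_eval_mul_sin_eq_sum` (polynomials);
* `tsum_alternating_eq` : `∑ (-1)^{m} m^{-s} = -(1 - 2/2ˢ) ζ(s)`;
* `integral_polynomial_mul_cot` : **the theorem** above.

Mathlib has the cotangent partial fractions and `∫ xⁿ`, `∫ sin`, but no cotangent moment integrals
or Clausen functions (searched `Clausen`, `cot` under `SpecialFunctions/Integrals`).

## References

* [LaiLupuOrr2026] L. Lai, C. Lupu, D. Orr, *Elementary proofs of Zagier's formula for multiple zeta
  values and its odd variant*, Proc. AMS 154 (2026), 11–24 (arXiv:2201.09262), Lemmas 2.1–2.3.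
-/

noncomputable section

open Filter Set Real MeasureTheory intervalIntegral Polynomial
open scoped Topology BigOperators Nat Polynomial

namespace Literature.Analysis.SpecialFunctions

/-! ### The Abel-summed cotangent kernel -/

/-- The Abel-summed cotangent kernel `κ_r(θ) = 2 r sin θ / (1 - 2 r cos θ + r²) = ∑_{m ≥ 1} 2 rᵐ sin(mθ)`
(twice the imaginary part of `re^{iθ}/(1 - re^{iθ})`); `κ_1(θ) = cot(θ/2)`. [folklore] -/
def abelCotKernel (r θ : ℝ) : ℝ := 2 * r * Real.sin θ / (1 - 2 * r * Real.cos θ + r ^ 2)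

/-- The denominator `1 - 2r cos θ + r² = (1-r)² + 4r sin²(θ/2)`. [folklore] -/
theorem one_sub_two_mul_cos_add_sq (r θ : ℝ) :
    1 - 2 * r * Real.cos θ + r ^ 2 = (1 - r) ^ 2 + 4 * r * Real.sin (θ / 2) ^ 2 := by
  have h1 := Real.cos_two_mul (θ / 2)
  rw [show 2 * (θ / 2) = θ by ring] at h1
  have h2 := Real.sin_sq_add_cos_sq (θ / 2)
  linear_combination (-2 * r) * h1 + (-4 * r) * h2

/-- The denominator is positive for `0 ≤ r < 1`. [folklore] -/
theorem abelCotKernel_den_pos {r : ℝ} (hr0 : 0 ≤ r) (hr1 : r < 1) (θ : ℝ) :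
    0 < 1 - 2 * r * Real.cos θ + r ^ 2 := by
  rw [one_sub_two_mul_cos_add_sq]
  have h1 : 0 < 1 - r := by linarith
  have h2 : 0 < (1 - r) ^ 2 := by positivity
  have h3 : 0 ≤ 4 * r * Real.sin (θ / 2) ^ 2 := by positivity
  linarith

/-- **Abel summation of the cotangent kernel**: `∑_{m ≥ 1} 2 rᵐ sin(mθ) = κ_r(θ)` for `0 ≤ r < 1`.
[folklore] -/
theorem hasSum_abelCotKernel {r : ℝ} (hr0 : 0 ≤ r) (hr1 : r < 1) (θ : ℝ) :
    HasSum (fun m : ℕ => 2 * r ^ (m + 1) * Real.sin ((m + 1) * θ)) (abelCotKernel r θ) := by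
  set z : ℂ := (r : ℂ) * Complex.exp (θ * Complex.I) with hz
  have hz_norm : ‖z‖ < 1 := by
    rw [hz, norm_mul, Complex.norm_real, Complex.norm_exp_ofReal_mul_I, mul_one, Real.norm_eq_abs,
      abs_of_nonneg hr0]
    exact hr1
  have hgeom := hasSum_geometric_of_norm_lt_one hz_norm
  have h1 : HasSum (fun n : ℕ => z ^ (n + 1)) (z * (1 - z)⁻¹) := by
    simpa [pow_succ', mul_comm] using hgeom.mul_left z
  have h2 := h1.mapL Complex.imCLM
  simp only [Complex.imCLM_apply] at h2
  have him : ∀ n : ℕ, (z ^ (n + 1)).im = r ^ (n + 1) * Real.sin ((n + 1) * θ) := by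
    intro n
    rw [hz, mul_pow, ← Complex.exp_nat_mul, ← Complex.ofReal_pow, Complex.im_ofReal_mul]
    congr 1
    have : ((n + 1 : ℕ) : ℂ) * (θ * Complex.I) = (((n + 1 : ℕ) : ℝ) * θ : ℝ) * Complex.I := by
      push_cast; ring
    rw [this, Complex.exp_ofReal_mul_I_im]
    push_cast; ring_nf
  have hzre : z.re = r * Real.cos θ := by
    rw [hz, Complex.re_ofReal_mul, Complex.exp_ofReal_mul_I_re]
  have hzim : z.im = r * Real.sin θ := by
    rw [hz, Complex.im_ofReal_mul, Complex.exp_ofReal_mul_I_im]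
  have hden := abelCotKernel_den_pos hr0 hr1 θ
  have hN : Complex.normSq (1 - z) = 1 - 2 * r * Real.cos θ + r ^ 2 := by
    rw [Complex.normSq_apply]
    simp only [Complex.sub_re, Complex.one_re, Complex.sub_im, Complex.one_im, hzre, hzim]
    nlinarith [Real.sin_sq_add_cos_sq θ]
  have hval : (z * (1 - z)⁻¹).im = r * Real.sin θ / (1 - 2 * r * Real.cos θ + r ^ 2) := by
    rw [Complex.mul_im, Complex.inv_re, Complex.inv_im, hN]
    simp only [Complex.sub_re, Complex.one_re, Complex.sub_im, Complex.one_im, hzre, hzim]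
    field_simp
    ring
  rw [hval] at h2
  have h3 := h2.mul_left 2
  simp only [him] at h3
  have e : abelCotKernel r θ = 2 * (r * Real.sin θ / (1 - 2 * r * Real.cos θ + r ^ 2)) := by
    unfold abelCotKernel; ring
  have e2 : (fun m : ℕ => 2 * r ^ (m + 1) * Real.sin ((m + 1) * θ)) =
      fun i : ℕ => 2 * (r ^ (i + 1) * Real.sin (((i : ℝ) + 1) * θ)) := by
    funext n; ring
  rw [e, e2]
  exact h3

/-- The bound `|κ_r(θ)| ≤ |cos(θ/2)| / |sin(θ/2)| = |cot(θ/2)|` for `0 ≤ r ≤ 1`, `sin(θ/2) ≠ 0`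
(from `1 - 2r cos θ + r² ≥ 4r sin²(θ/2)` and `sin θ = 2 sin(θ/2) cos(θ/2)`). [folklore] -/
theorem abs_abelCotKernel_le {r θ : ℝ} (hr0 : 0 ≤ r) (hθ : Real.sin (θ / 2) ≠ 0) :
    |abelCotKernel r θ| ≤ |Real.cos (θ / 2)| / |Real.sin (θ / 2)| := by
  rcases hr0.eq_or_lt with rfl | hr
  · simp [abelCotKernel]; positivity
  · have hs2 : 0 < Real.sin (θ / 2) ^ 2 := by positivity
    have hlow : 4 * r * Real.sin (θ / 2) ^ 2 ≤ 1 - 2 * r * Real.cos θ + r ^ 2 := by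
      rw [one_sub_two_mul_cos_add_sq]; nlinarith [sq_nonneg (1 - r)]
    have hD : 0 < 1 - 2 * r * Real.cos θ + r ^ 2 := lt_of_lt_of_le (by positivity) hlow
    have hsin : Real.sin θ = 2 * Real.sin (θ / 2) * Real.cos (θ / 2) := by
      rw [← Real.sin_two_mul]; ring_nf
    unfold abelCotKernel
    rw [abs_div, abs_of_pos hD]
    calc |2 * r * Real.sin θ| / (1 - 2 * r * Real.cos θ + r ^ 2)
        ≤ |2 * r * Real.sin θ| / (4 * r * Real.sin (θ / 2) ^ 2) :=
          div_le_div_of_nonneg_left (abs_nonneg _) (by positivity) hlow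
      _ = |Real.cos (θ / 2)| / |Real.sin (θ / 2)| := by
          rw [hsin]
          simp only [abs_mul, abs_two, abs_of_pos hr]
          have hss : Real.sin (θ / 2) ^ 2 = |Real.sin (θ / 2)| ^ 2 := (sq_abs _).symm
          rw [hss]
          have : 0 < |Real.sin (θ / 2)| := abs_pos.2 hθ
          field_simp
          ring

/-- The pointwise limit `κ_r(θ) → cot(θ/2)` as `r → 1` (`sin(θ/2) ≠ 0`). [folklore] -/
theorem tendsto_abelCotKernel {θ : ℝ} (hθ : Real.sin (θ / 2) ≠ 0) :
    Tendsto (fun r => abelCotKernel r θ) (𝓝 1) (𝓝 (Real.cos (θ / 2) / Real.sin (θ / 2))) := by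
  have hden1 : (1 : ℝ) - 2 * 1 * Real.cos θ + 1 ^ 2 = 4 * Real.sin (θ / 2) ^ 2 := by
    rw [one_sub_two_mul_cos_add_sq]; ring
  have hs2 : (4 : ℝ) * Real.sin (θ / 2) ^ 2 ≠ 0 := by positivity
  have hcont : ContinuousAt (fun r : ℝ => abelCotKernel r θ) 1 := by
    unfold abelCotKernel
    refine ContinuousAt.div (by fun_prop) (by fun_prop) ?_
    rw [hden1]; exact hs2
  have hval : abelCotKernel 1 θ = Real.cos (θ / 2) / Real.sin (θ / 2) := by
    unfold abelCotKernel
    rw [hden1]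
    have hsin : Real.sin θ = 2 * Real.sin (θ / 2) * Real.cos (θ / 2) := by
      rw [← Real.sin_two_mul]; ring_nf
    rw [hsin]
    field_simp
    ring
  rw [← hval]
  exact hcont.tendsto

/-- `κ_r(π x)` is continuous in `x` for `0 ≤ r < 1`. [folklore] -/
theorem continuous_abelCotKernel {r : ℝ} (hr0 : 0 ≤ r) (hr1 : r < 1) :
    Continuous fun x : ℝ => abelCotKernel r (π * x) := by
  unfold abelCotKernel
  refine Continuous.div (by fun_prop) (by fun_prop) fun x => (abelCotKernel_den_pos hr0 hr1 _).ne'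

/-! ### Integration by parts against `sin (μx)`, `cos (μx)` for polynomials -/

/-- `∫₀¹ Q(x) sin(μx) dx = (Q(0) - cos μ · Q(1))/μ + μ⁻¹ ∫₀¹ Q'(x) cos(μx) dx` (`μ ≠ 0`). [folklore] -/
theorem integral_eval_mul_sin (Q : ℝ[X]) {μ : ℝ} (hμ : μ ≠ 0) :
    ∫ x in (0 : ℝ)..1, Q.eval x * Real.sin (μ * x) =
      (Q.eval 0 - Real.cos μ * Q.eval 1) / μ +
        μ⁻¹ * ∫ x in (0 : ℝ)..1, (derivative Q).eval x * Real.cos (μ * x) := by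
  have hu : ∀ x ∈ uIcc (0 : ℝ) 1, HasDerivAt (fun x => Q.eval x) ((derivative Q).eval x) x :=
    fun x _ => Q.hasDerivAt x
  have hv : ∀ x ∈ uIcc (0 : ℝ) 1,
      HasDerivAt (fun x => -Real.cos (μ * x) / μ) (Real.sin (μ * x)) x := by
    intro x _
    have h1 : HasDerivAt (fun y : ℝ => μ * y) μ x := by
      simpa using (hasDerivAt_id x).const_mul μ
    have h2 : HasDerivAt (fun y : ℝ => Real.cos (μ * y)) (-Real.sin (μ * x) * μ) x :=
      (Real.hasDerivAt_cos (μ * x)).comp x h1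
    have h3 : HasDerivAt (fun y : ℝ => -Real.cos (μ * y) / μ) (-(-Real.sin (μ * x) * μ) / μ) x :=
      h2.neg.div_const μ
    refine h3.congr_deriv ?_
    field_simp
  have hu' : IntervalIntegrable (fun x => (derivative Q).eval x) volume (0 : ℝ) 1 :=
    (derivative Q).continuous.intervalIntegrable _ _
  have hv' : IntervalIntegrable (fun x => Real.sin (μ * x)) volume (0 : ℝ) 1 :=
    (by fun_prop : Continuous fun x => Real.sin (μ * x)).intervalIntegrable _ _
  have h := integral_mul_deriv_eq_deriv_mul hu hv hu' hv'
  rw [h]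
  simp only [mul_zero, Real.cos_zero, mul_one]
  have e : ∫ x in (0 : ℝ)..1, (derivative Q).eval x * (-Real.cos (μ * x) / μ) =
      -(μ⁻¹ * ∫ x in (0 : ℝ)..1, (derivative Q).eval x * Real.cos (μ * x)) := by
    rw [← intervalIntegral.integral_const_mul, ← intervalIntegral.integral_neg]
    congr 1; funext x; field_simp
  rw [e]
  field_simp
  ring

/-- `∫₀¹ Q(x) cos(μx) dx = sin μ · Q(1)/μ - μ⁻¹ ∫₀¹ Q'(x) sin(μx) dx` (`μ ≠ 0`). [folklore] -/
theorem integral_eval_mul_cos (Q : ℝ[X]) {μ : ℝ} (hμ : μ ≠ 0) :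
    ∫ x in (0 : ℝ)..1, Q.eval x * Real.cos (μ * x) =
      Real.sin μ * Q.eval 1 / μ -
        μ⁻¹ * ∫ x in (0 : ℝ)..1, (derivative Q).eval x * Real.sin (μ * x) := by
  have hu : ∀ x ∈ uIcc (0 : ℝ) 1, HasDerivAt (fun x => Q.eval x) ((derivative Q).eval x) x :=
    fun x _ => Q.hasDerivAt x
  have hv : ∀ x ∈ uIcc (0 : ℝ) 1,
      HasDerivAt (fun x => Real.sin (μ * x) / μ) (Real.cos (μ * x)) x := by
    intro x _
    have h1 : HasDerivAt (fun y : ℝ => μ * y) μ x := by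
      simpa using (hasDerivAt_id x).const_mul μ
    have h2 : HasDerivAt (fun y : ℝ => Real.sin (μ * y)) (Real.cos (μ * x) * μ) x :=
      (Real.hasDerivAt_sin (μ * x)).comp x h1
    have h3 : HasDerivAt (fun y : ℝ => Real.sin (μ * y) / μ) (Real.cos (μ * x) * μ / μ) x :=
      h2.div_const μ
    refine h3.congr_deriv ?_
    field_simp
  have hu' : IntervalIntegrable (fun x => (derivative Q).eval x) volume (0 : ℝ) 1 :=
    (derivative Q).continuous.intervalIntegrable _ _
  have hv' : IntervalIntegrable (fun x => Real.cos (μ * x)) volume (0 : ℝ) 1 :=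
    (by fun_prop : Continuous fun x => Real.cos (μ * x)).intervalIntegrable _ _
  have h := integral_mul_deriv_eq_deriv_mul hu hv hu' hv'
  rw [h]
  simp only [mul_zero, Real.sin_zero, zero_div, mul_one]
  have e : ∫ x in (0 : ℝ)..1, (derivative Q).eval x * (Real.sin (μ * x) / μ) =
      μ⁻¹ * ∫ x in (0 : ℝ)..1, (derivative Q).eval x * Real.sin (μ * x) := by
    rw [← intervalIntegral.integral_const_mul]
    congr 1; funext x; field_simp
  rw [e]
  field_simp
  ring

/-- **The moments `∫₀¹ Q(x) sin(mπx) dx` of a polynomial** by repeated integration by parts: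
if `Q⁽²ᴺ⁾ = 0` then
`∫₀¹ Q(x) sin(mπx) dx = ∑_{j<N} (-1)ʲ [Q⁽²ʲ⁾(0) - (-1)ᵐ Q⁽²ʲ⁾(1)] / (mπ)^{2j+1}` (`m ≥ 1`).
[cite: LaiLupuOrr2026, Lemma 2.1] -/
theorem integral_eval_mul_sin_eq_sum (m : ℕ) (hm : m ≠ 0) : ∀ (N : ℕ) (Q : ℝ[X]),
    derivative^[2 * N] Q = 0 →
    ∫ x in (0 : ℝ)..1, Q.eval x * Real.sin (m * π * x) =
      ∑ j ∈ Finset.range N, (-1 : ℝ) ^ j *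
        ((derivative^[2 * j] Q).eval 0 - (-1) ^ m * (derivative^[2 * j] Q).eval 1) /
          (m * π) ^ (2 * j + 1)
  | 0, Q, hQ => by
      simp only [Nat.mul_zero, Function.iterate_zero, id_eq] at hQ
      subst hQ
      simp
  | N + 1, Q, hQ => by
      have hμ : (m : ℝ) * π ≠ 0 := by positivity
      have hcos : Real.cos (m * π) = (-1) ^ m := Real.cos_nat_mul_pi m
      have hsin : Real.sin (m * π) = 0 := Real.sin_nat_mul_pi m
      -- two integrations by parts
      rw [integral_eval_mul_sin Q hμ, integral_eval_mul_cos (derivative Q) hμ, hcos, hsin]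
      simp only [zero_mul, zero_div, zero_sub]
      -- the induction hypothesis for Q''
      have hQ'' : derivative^[2 * N] (derivative^[2] Q) = 0 := by
        rw [← Function.iterate_add_apply, show 2 * N + 2 = 2 * (N + 1) by ring]; exact hQ
      have ih := integral_eval_mul_sin_eq_sum m hm N (derivative^[2] Q) hQ''
      simp only [Function.iterate_succ, Function.iterate_zero, Function.comp_apply, id_eq] at ih
      rw [ih, Finset.sum_range_succ']
      conv_rhs => rw [add_comm]
      simp only [Nat.mul_zero, Function.iterate_zero, id_eq, pow_zero, one_mul, zero_add, pow_one]
      congr 1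
      rw [Finset.mul_sum, ← Finset.sum_neg_distrib, Finset.mul_sum]
      refine Finset.sum_congr rfl fun j _ => ?_
      have e2 : derivative^[2 * (j + 1)] Q = derivative^[2 * j] (derivative (derivative Q)) := by
        rw [show 2 * (j + 1) = 2 * j + 2 by ring, Function.iterate_add_apply]
        simp
      rw [e2, show 2 * (j + 1) + 1 = 2 * j + 1 + 2 by ring, pow_add, pow_succ (-1 : ℝ) j]
      field_simp
      ring

/-! ### The alternating zeta value -/

/-- `∑_{m ≥ 1} 1/mˢ` is summable for `s ≥ 2` (as a sum over `m + 1`, `m : ℕ`). [folklore] -/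
theorem summable_one_div_succ_pow {s : ℕ} (hs : 2 ≤ s) :
    Summable fun m : ℕ => 1 / ((m : ℝ) + 1) ^ s := by
  have h := (Real.summable_one_div_nat_pow.mpr (by omega : 1 < s))
  simpa using (summable_nat_add_iff 1).mpr h

/-- **The alternating zeta value**: `∑_{m ≥ 1} (-1)ᵐ/mˢ = -(1 - 2/2ˢ) ∑_{m ≥ 1} 1/mˢ` (`s ≥ 2`),
by splitting both series into even and odd terms. [folklore] -/
theorem tsum_alternating_eq {s : ℕ} (hs : 2 ≤ s) :
    ∑' m : ℕ, (-1 : ℝ) ^ (m + 1) / ((m : ℝ) + 1) ^ s =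
      -(1 - 2 / 2 ^ s) * ∑' m : ℕ, 1 / ((m : ℝ) + 1) ^ s := by
  -- work with `f k = 1/kˢ`, `g k = (-1)ᵏ/kˢ` on all of `ℕ` (the `k = 0` terms vanish, `s ≥ 1`)
  set f : ℕ → ℝ := fun k => 1 / (k : ℝ) ^ s with hf
  set g : ℕ → ℝ := fun k => (-1 : ℝ) ^ k / (k : ℝ) ^ s with hg
  have hs0 : s ≠ 0 := by omega
  have hf0 : f 0 = 0 := by simp [hf, hs0]
  have hg0 : g 0 = 0 := by simp [hg, hs0]
  have hfs : Summable f := Real.summable_one_div_nat_pow.mpr (by omega : 1 < s)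
  have hgs : Summable g := by
    refine Summable.of_norm_bounded hfs fun k => ?_
    simp [hf, hg]
  -- the two target sums are `∑ f (k+1)` and `∑ g (k+1)`
  have eF : ∑' m : ℕ, 1 / ((m : ℝ) + 1) ^ s = ∑' k, f k := by
    rw [hfs.tsum_eq_zero_add, hf0, zero_add]; simp [hf]
  have eG : ∑' m : ℕ, (-1 : ℝ) ^ (m + 1) / ((m : ℝ) + 1) ^ s = ∑' k, g k := by
    rw [hgs.tsum_eq_zero_add, hg0, zero_add]; simp [hg]
  rw [eF, eG]
  -- even and odd parts of `f`
  have h2s : (2 : ℝ) ^ s ≠ 0 := by positivity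
  have hfe_eq : ∀ k : ℕ, f (2 * k) = (1 / 2 ^ s) * f k := by
    intro k; simp only [hf]; push_cast; rw [mul_pow]; field_simp
  have hge_eq : ∀ k : ℕ, g (2 * k) = (1 / 2 ^ s) * f k := by
    intro k; simp only [hf, hg]; push_cast
    rw [mul_pow, pow_mul]; norm_num; field_simp
  have hgo_eq : ∀ k : ℕ, g (2 * k + 1) = -f (2 * k + 1) := by
    intro k; simp only [hf, hg]; rw [pow_succ, pow_mul]; norm_num; ring
  have hfe : HasSum (fun k => f (2 * k)) ((1 / 2 ^ s) * ∑' k, f k) := by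
    have e : (fun k => f (2 * k)) = fun k => 1 / 2 ^ s * f k := funext hfe_eq
    rw [e]; exact hfs.hasSum.mul_left _
  have hfo_s : Summable fun k => f (2 * k + 1) :=
    hfs.comp_injective ((add_left_injective 1).comp (mul_right_injective₀ two_ne_zero))
  obtain ⟨O, hfo⟩ := hfo_s
  have hFsplit : ∑' k, f k = (1 / 2 ^ s) * (∑' k, f k) + O := (hfe.even_add_odd hfo).tsum_eq
  have hge : HasSum (fun k => g (2 * k)) ((1 / 2 ^ s) * ∑' k, f k) := by
    have e : (fun k => g (2 * k)) = fun k => 1 / 2 ^ s * f k := funext hge_eq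
    rw [e]; exact hfs.hasSum.mul_left _
  have hgo : HasSum (fun k => g (2 * k + 1)) (-O) := by
    have e : (fun k => g (2 * k + 1)) = fun k => -f (2 * k + 1) := funext hgo_eq
    rw [e]; exact hfo.neg
  rw [(hge.even_add_odd hgo).tsum_eq]
  set F := ∑' k, f k
  have hO : O = F - 1 / 2 ^ s * F := by linarith
  rw [hO]
  ring

/-- Abel's limit for `∑ rᵐ⁺¹ ε^{m+1}/(m+1)ˢ` (`ε = ±1`, `s ≥ 2`): as `r → 1⁻` it tends to `∑ ε^{m+1}/(m+1)ˢ`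
(dominated convergence for series). [folklore] -/
theorem tendsto_tsum_pow_div {s : ℕ} (hs : 2 ≤ s) (ε : ℝ) (hε : |ε| = 1) :
    Tendsto (fun r : ℝ => ∑' m : ℕ, (ε * r) ^ (m + 1) / ((m : ℝ) + 1) ^ s) (𝓝[<] 1)
      (𝓝 (∑' m : ℕ, ε ^ (m + 1) / ((m : ℝ) + 1) ^ s)) := by
  refine tendsto_tsum_of_dominated_convergence (summable_one_div_succ_pow hs) (fun m => ?_) ?_
  · have : Tendsto (fun r : ℝ => (ε * r) ^ (m + 1) / ((m : ℝ) + 1) ^ s) (𝓝 1)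
        (𝓝 ((ε * 1) ^ (m + 1) / ((m : ℝ) + 1) ^ s)) := by
      exact ((tendsto_id.const_mul ε).pow (m + 1)).div_const _
    rw [mul_one] at this
    exact this.mono_left nhdsWithin_le_nhds
  · have hr : ∀ᶠ r : ℝ in 𝓝[<] 1, r ∈ Set.Ioo (0 : ℝ) 1 := Ioo_mem_nhdsLT one_pos
    filter_upwards [hr] with r hr m
    rw [Set.mem_Ioo] at hr
    rw [Real.norm_eq_abs, abs_div, abs_pow, abs_mul, hε, one_mul, abs_of_pos hr.1,
      abs_of_pos (by positivity)]
    exact div_le_div_of_nonneg_right (pow_le_one₀ hr.1.le hr.2.le) (by positivity)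

/-! ### The theorem -/

/-- A polynomial vanishing at `0` is `x` times a polynomial: `|P(x)| ≤ C x` on `[0,1]`. [folklore] -/
theorem exists_bound_of_eval_zero (P : ℝ[X]) (h0 : P.eval 0 = 0) :
    ∃ C : ℝ, 0 ≤ C ∧ ∀ x ∈ Set.Icc (0 : ℝ) 1, |P.eval x| ≤ C * x := by
  have hdvd : X ∣ P := by rw [Polynomial.X_dvd_iff, Polynomial.coeff_zero_eq_eval_zero]; exact h0
  obtain ⟨Q, hQ⟩ := hdvd
  obtain ⟨C, hC⟩ := isCompact_Icc.exists_bound_of_continuousOn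
    (f := fun x => Q.eval x) (Q.continuous.continuousOn (s := Set.Icc (0 : ℝ) 1))
  refine ⟨max C 0, le_max_right _ _, fun x hx => ?_⟩
  rw [hQ, Polynomial.eval_mul, Polynomial.eval_X, abs_mul, abs_of_nonneg hx.1, mul_comm]
  exact mul_le_mul_of_nonneg_right ((hC x hx).trans (le_max_left _ _)) hx.1

/-- `t cot t ≤ 1` on `(0, π/2]`, i.e. `x · cot(πx/2) ≤ 2/π` on `(0,1]`, in the form
`x cos(πx/2) ≤ (2/π) sin(πx/2)`. [folklore] -/
theorem mul_cos_le_sin {x : ℝ} (hx0 : 0 ≤ x) (hx1 : x ≤ 1) :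
    x * Real.cos (π * x / 2) ≤ 2 / π * Real.sin (π * x / 2) := by
  rcases hx1.eq_or_lt with rfl | hx1
  · have h2 : (0 : ℝ) ≤ 2 / π := by positivity
    simpa using h2
  · have ht0 : 0 ≤ π * x / 2 := by positivity
    have ht1 : π * x / 2 < π / 2 := by nlinarith [Real.pi_pos]
    have hcos : 0 < Real.cos (π * x / 2) := Real.cos_pos_of_mem_Ioo ⟨by linarith [Real.pi_pos], ht1⟩
    have h := Real.le_tan ht0 ht1
    rw [Real.tan_eq_sin_div_cos, le_div_iff₀ hcos] at h
    have hπ := Real.pi_pos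
    rw [div_mul_eq_mul_div, le_div_iff₀ hπ]
    nlinarith

/-- `∑_m rᵐ⁺¹/(m+1)ˢ → ∑_m 1/(m+1)ˢ` as `r → 1⁻` (`s ≥ 2`; dominated convergence). [folklore] -/
theorem tendsto_tsum_pow_div_one {s : ℕ} (hs : 2 ≤ s) :
    Tendsto (fun r : ℝ => ∑' m : ℕ, r ^ (m + 1) / ((m : ℝ) + 1) ^ s) (𝓝[<] 1)
      (𝓝 (∑' m : ℕ, 1 / ((m : ℝ) + 1) ^ s)) := by
  have h := tendsto_tsum_pow_div hs 1 (by simp)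
  simp only [one_mul, one_pow] at h
  exact h

/-- `∑_m (-r)ᵐ⁺¹/(m+1)ˢ → ∑_m (-1)ᵐ⁺¹/(m+1)ˢ` as `r → 1⁻` (`s ≥ 2`). [folklore] -/
theorem tendsto_tsum_neg_pow_div {s : ℕ} (hs : 2 ≤ s) :
    Tendsto (fun r : ℝ => ∑' m : ℕ, (-r) ^ (m + 1) / ((m : ℝ) + 1) ^ s) (𝓝[<] 1)
      (𝓝 (∑' m : ℕ, (-1) ^ (m + 1) / ((m : ℝ) + 1) ^ s)) := by
  have h := tendsto_tsum_pow_div hs (-1) (by simp)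
  simp only [neg_one_mul] at h
  exact h

/-- Summability of `rᵐ⁺¹ εᵐ⁺¹/(m+1)ˢ`-type terms for `|q| ≤ 1`, `s ≥ 2`. [folklore] -/
theorem summable_pow_div_succ_pow {q : ℝ} (hq : |q| ≤ 1) {s : ℕ} (hs : 2 ≤ s) :
    Summable fun m : ℕ => q ^ (m + 1) / ((m : ℝ) + 1) ^ s := by
  refine Summable.of_norm_bounded (summable_one_div_succ_pow hs) fun m => ?_
  rw [Real.norm_eq_abs, abs_div, abs_pow, abs_of_pos (by positivity : (0 : ℝ) < ((m : ℝ) + 1) ^ s)]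
  exact div_le_div_of_nonneg_right (pow_le_one₀ (abs_nonneg q) hq) (by positivity)

/-- **Cotangent moments of a polynomial vanishing at the endpoints** (Lai–Lupu–Orr 2026, Lemma 2.3,
the case `P(1) = 0`, no `log 2` term): if `P(0) = P(1) = 0` and `deg P < 2N`, then
`∫₀¹ P(x) cot(πx/2) dx = 2 ∑_{1 ≤ j < N} (-1)ʲ [P⁽²ʲ⁾(0) + (1 - 4⁻ʲ) P⁽²ʲ⁾(1)] ζ(2j+1) / π^{2j+1}`,
`ζ(2j+1) = ∑_{m ≥ 0} (m+1)^{-(2j+1)}`. [cite: LaiLupuOrr2026, Lemma 2.3] -/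
theorem integral_polynomial_mul_cot (P : ℝ[X]) (h0 : P.eval 0 = 0) (h1 : P.eval 1 = 0) {N : ℕ}
    (hN : P.natDegree < 2 * N) :
    ∫ x in (0 : ℝ)..1, P.eval x * (Real.cos (π * x / 2) / Real.sin (π * x / 2)) =
      2 * ∑ j ∈ Finset.Ico 1 N, (-1 : ℝ) ^ j *
        ((derivative^[2 * j] P).eval 0 + (1 - 1 / 4 ^ j) * (derivative^[2 * j] P).eval 1) *
          (∑' m : ℕ, 1 / ((m : ℝ) + 1) ^ (2 * j + 1)) / π ^ (2 * j + 1) := by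
  have hπ := Real.pi_pos
  have hderiv0 : derivative^[2 * N] P = 0 := Polynomial.iterate_derivative_eq_zero hN
  -- the coefficients of the closed form and the zeta sums
  set c0 : ℕ → ℝ := fun j => (derivative^[2 * j] P).eval 0 with hc0
  set c1 : ℕ → ℝ := fun j => (derivative^[2 * j] P).eval 1 with hc1
  set ζs : ℕ → ℝ := fun j => ∑' m : ℕ, 1 / ((m : ℝ) + 1) ^ (2 * j + 1) with hζs
  set ηs : ℕ → ℝ := fun j => ∑' m : ℕ, (-1) ^ (m + 1) / ((m : ℝ) + 1) ^ (2 * j + 1) with hηs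
  set A : ℕ → ℝ → ℝ := fun j r => ∑' m : ℕ, r ^ (m + 1) / ((m : ℝ) + 1) ^ (2 * j + 1) with hA
  set B : ℕ → ℝ → ℝ := fun j r => ∑' m : ℕ, (-r) ^ (m + 1) / ((m : ℝ) + 1) ^ (2 * j + 1) with hB
  -- Step 1: the sine moments of P (the j = 0 term vanishes since P(0) = P(1) = 0)
  have hIs : ∀ m : ℕ, ∫ x in (0 : ℝ)..1, P.eval x * Real.sin ((m + 1) * π * x) =
      ∑ j ∈ Finset.Ico 1 N, (-1 : ℝ) ^ j * (c0 j - (-1) ^ (m + 1) * c1 j) /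
        ((m + 1) * π) ^ (2 * j + 1) := by
    intro m
    have h := integral_eval_mul_sin_eq_sum (m + 1) (Nat.succ_ne_zero m) N P hderiv0
    push_cast at h
    rw [h, Finset.range_eq_Ico]
    rcases Nat.eq_zero_or_pos N with rfl | hNpos
    · simp
    · rw [Finset.sum_eq_sum_Ico_succ_bot hNpos]
      simp [hc0, hc1, h0, h1]
  -- Step 2: for 0 ≤ r < 1, ∫ P κ_r(π·) = F r
  set F : ℝ → ℝ := fun r => ∑ j ∈ Finset.Ico 1 N,
    (-1 : ℝ) ^ j * (2 / π ^ (2 * j + 1)) * (c0 j * A j r - c1 j * B j r) with hF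
  have hIF : ∀ r : ℝ, 0 ≤ r → r < 1 →
      ∫ x in (0 : ℝ)..1, P.eval x * abelCotKernel r (π * x) = F r := by
    intro r hr0 hr1
    -- the series over m, integrated termwise
    obtain ⟨CP, hCP⟩ := isCompact_Icc.exists_bound_of_continuousOn
      (f := fun x => P.eval x) (P.continuous.continuousOn (s := Set.Icc (0 : ℝ) 1))
    have hCP0 : 0 ≤ CP := (norm_nonneg _).trans (hCP 0 (by simp))
    have hser : HasSum (fun m : ℕ => ∫ x in (0 : ℝ)..1,
        P.eval x * (2 * r ^ (m + 1) * Real.sin ((m + 1) * (π * x))))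
        (∫ x in (0 : ℝ)..1, P.eval x * abelCotKernel r (π * x)) := by
      refine intervalIntegral.hasSum_integral_of_dominated_convergence
        (fun m _ => CP * (2 * r ^ (m + 1))) (fun m => ?_) (fun m => ?_) ?_ ?_ ?_
      · exact (Continuous.aestronglyMeasurable (by fun_prop))
      · refine ae_of_all _ fun x hx => ?_
        rw [Set.uIoc_of_le zero_le_one] at hx
        rw [norm_mul, norm_mul, Real.norm_eq_abs (Real.sin _)]
        refine mul_le_mul (hCP x ⟨hx.1.le, hx.2⟩) ?_ (by positivity) hCP0
        rw [Real.norm_eq_abs, abs_of_nonneg (by positivity)]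
        exact mul_le_of_le_one_right (by positivity) (Real.abs_sin_le_one _)
      · exact ae_of_all _ fun x _ => ((summable_geometric_of_lt_one hr0 hr1).mul_left
          (CP * (2 * r))).congr fun m => by ring
      · exact intervalIntegrable_const
      · refine ae_of_all _ fun x _ => ?_
        exact (hasSum_abelCotKernel hr0 hr1 (π * x)).mul_left (P.eval x)
    -- each term integral, computed
    have hterm : ∀ m : ℕ, ∫ x in (0 : ℝ)..1,
        P.eval x * (2 * r ^ (m + 1) * Real.sin ((m + 1) * (π * x))) =
        ∑ j ∈ Finset.Ico 1 N, (-1 : ℝ) ^ j * (2 / π ^ (2 * j + 1)) *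
          (c0 j * (r ^ (m + 1) / ((m : ℝ) + 1) ^ (2 * j + 1)) -
            c1 j * ((-r) ^ (m + 1) / ((m : ℝ) + 1) ^ (2 * j + 1))) := by
      intro m
      have e : (fun x => P.eval x * (2 * r ^ (m + 1) * Real.sin ((m + 1) * (π * x)))) =
          fun x => (2 * r ^ (m + 1)) * (P.eval x * Real.sin ((m + 1) * π * x)) := by
        funext x; rw [← mul_assoc ((m : ℝ) + 1) π x]; ring
      rw [e, intervalIntegral.integral_const_mul, hIs m, Finset.mul_sum]
      refine Finset.sum_congr rfl fun j _ => ?_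
      have hm1 : ((m : ℝ) + 1) ≠ 0 := by positivity
      have hπ0 : (π : ℝ) ≠ 0 := Real.pi_ne_zero
      rw [mul_pow, neg_pow r]
      field_simp
    simp_rw [hterm] at hser
    -- sum over m of the finite sums
    have hsum : HasSum (fun m : ℕ => ∑ j ∈ Finset.Ico 1 N, (-1 : ℝ) ^ j * (2 / π ^ (2 * j + 1)) *
          (c0 j * (r ^ (m + 1) / ((m : ℝ) + 1) ^ (2 * j + 1)) -
            c1 j * ((-r) ^ (m + 1) / ((m : ℝ) + 1) ^ (2 * j + 1)))) (F r) := by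
      refine hasSum_sum fun j hj => ?_
      rw [Finset.mem_Ico] at hj
      have hs : 2 ≤ 2 * j + 1 := by omega
      have hAj : HasSum (fun m : ℕ => r ^ (m + 1) / ((m : ℝ) + 1) ^ (2 * j + 1)) (A j r) :=
        (summable_pow_div_succ_pow (by rw [abs_of_nonneg hr0]; exact hr1.le) hs).hasSum
      have hBj : HasSum (fun m : ℕ => (-r) ^ (m + 1) / ((m : ℝ) + 1) ^ (2 * j + 1)) (B j r) :=
        (summable_pow_div_succ_pow (by rw [abs_neg, abs_of_nonneg hr0]; exact hr1.le) hs).hasSum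
      exact ((hAj.mul_left (c0 j)).sub (hBj.mul_left (c1 j))).mul_left _
    exact hser.unique hsum
  -- Step 3: F r → F1 as r → 1⁻
  set F1 : ℝ := ∑ j ∈ Finset.Ico 1 N,
    (-1 : ℝ) ^ j * (2 / π ^ (2 * j + 1)) * (c0 j * ζs j - c1 j * ηs j) with hF1
  have hFlim : Tendsto F (𝓝[<] 1) (𝓝 F1) := by
    refine tendsto_finsetSum _ fun j hj => ?_
    rw [Finset.mem_Ico] at hj
    have hs : 2 ≤ 2 * j + 1 := by omega
    exact (((tendsto_tsum_pow_div_one hs).const_mul (c0 j)).sub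
      ((tendsto_tsum_neg_pow_div hs).const_mul (c1 j))).const_mul _
  have hIlim1 : Tendsto (fun r => ∫ x in (0 : ℝ)..1, P.eval x * abelCotKernel r (π * x))
      (𝓝[<] 1) (𝓝 F1) := by
    refine hFlim.congr' ?_
    filter_upwards [Ioo_mem_nhdsLT one_pos] with r hr
    exact (hIF r hr.1.le hr.2).symm
  -- Step 4: ∫ P κ_r(π·) → ∫ P cot(π·/2) (dominated convergence)
  obtain ⟨C, hC0, hC⟩ := exists_bound_of_eval_zero P h0
  have hIlim2 : Tendsto (fun r => ∫ x in (0 : ℝ)..1, P.eval x * abelCotKernel r (π * x))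
      (𝓝[<] 1) (𝓝 (∫ x in (0 : ℝ)..1, P.eval x * (Real.cos (π * x / 2) / Real.sin (π * x / 2)))) := by
    refine intervalIntegral.tendsto_integral_filter_of_dominated_convergence (fun _ => C * (2 / π))
      ?_ ?_ intervalIntegrable_const ?_
    · filter_upwards [Ioo_mem_nhdsLT one_pos] with r hr
      exact ((P.continuous.mul (continuous_abelCotKernel hr.1.le hr.2)).aestronglyMeasurable)
    · filter_upwards [Ioo_mem_nhdsLT one_pos] with r hr
      refine ae_of_all _ fun x hx => ?_
      rw [Set.uIoc_of_le zero_le_one] at hx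
      have hx2 : 0 < π * x / 2 := by nlinarith [hx.1]
      have hx3 : π * x / 2 ≤ π / 2 := by nlinarith [hx.2]
      have hsin : 0 < Real.sin (π * x / 2) := Real.sin_pos_of_pos_of_lt_pi hx2 (by linarith)
      have hcos : 0 ≤ Real.cos (π * x / 2) := Real.cos_nonneg_of_mem_Icc ⟨by linarith, hx3⟩
      have hk := abs_abelCotKernel_le (θ := π * x) hr.1.le hsin.ne'
      rw [abs_of_nonneg hcos, abs_of_pos hsin] at hk
      rw [norm_mul, Real.norm_eq_abs, Real.norm_eq_abs]
      calc |P.eval x| * |abelCotKernel r (π * x)|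
          ≤ (C * x) * (Real.cos (π * x / 2) / Real.sin (π * x / 2)) :=
            mul_le_mul (hC x ⟨hx.1.le, hx.2⟩) hk (abs_nonneg _) (mul_nonneg hC0 hx.1.le)
        _ = C * (x * Real.cos (π * x / 2) / Real.sin (π * x / 2)) := by ring
        _ ≤ C * (2 / π) := by
            refine mul_le_mul_of_nonneg_left ?_ hC0
            rw [div_le_iff₀ hsin]
            exact mul_cos_le_sin hx.1.le hx.2
    · refine ae_of_all _ fun x hx => ?_
      rw [Set.uIoc_of_le zero_le_one] at hx
      have hx2 : 0 < π * x / 2 := by nlinarith [hx.1]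
      have hsin : 0 < Real.sin (π * x / 2) := Real.sin_pos_of_pos_of_lt_pi hx2 (by nlinarith [hx.2])
      exact ((tendsto_abelCotKernel (θ := π * x) hsin.ne').mono_left nhdsWithin_le_nhds).const_mul
        (P.eval x)
  -- Step 5: identify the two limits and rewrite the alternating sums
  have heq := tendsto_nhds_unique hIlim2 hIlim1
  rw [heq, hF1, Finset.mul_sum]
  refine Finset.sum_congr rfl fun j hj => ?_
  rw [Finset.mem_Ico] at hj
  have hs : 2 ≤ 2 * j + 1 := by omega
  have hη : ηs j = -(1 - 2 / 2 ^ (2 * j + 1)) * ζs j := tsum_alternating_eq hs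
  have h4 : (2 : ℝ) / 2 ^ (2 * j + 1) = 1 / 4 ^ j := by
    rw [pow_succ, pow_mul, show (2 : ℝ) ^ 2 = 4 by norm_num]
    field_simp
  rw [hη, h4]
  have hπj : π ^ (2 * j + 1) ≠ 0 := by positivity
  field_simp
  ring

end Literature.Analysis.SpecialFunctions
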